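import Summits.ResolutionOfSingularities.ResolutionOfSingularities.Theorems.EquisingularLiftEquisingularLiftNatOccursAsSingularLocus
import Literature.RingTheory.RegularLocalRing.HypersurfaceDepth
import Literature.AlgebraicGeometry.Resolution.NagataCriterion
import Mathlib.RingTheory.LocalProperties.Reduced
import Mathlib.RingTheory.Jacobson.Ring
import Mathlib.RingTheory.Ideal.MinimalPrime.Localization
import Mathlib.RingTheory.Ideal.KrullsHeightTheorem
import HarnessLib

/-!
# [OURS · L1 W4.5(b)] Helper H-L0b, part (R): the generic member of the `𝔭²`-system is REDUCED

NOT a statement of any manuscript. Helper file of the chain res-L1-w45b (CRUX-PLAN v3.0.1 §1.3 (b) /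
§4 «H-L0b `occurs_as_singular_locus`: generic `G ∈ 𝓘_Σ²(d)` **integral** with `Sing = Σ`», CHAIN v7 §3
row H-L0b, sub-part (R) «reducedness», released 2026-08-27 by the author of parts 1–3), in the
AFFINE LOCAL-ALGEBRA CURRENCY of `occurs_as_singular_locus`
(`…Theorems.EquisingularLiftEquisingularLiftNatOccursAsSingularLocus`, p500339): `A` a regular domain
of finite type over a field `k`, `𝔭 ⊆ A` an ideal (the chart of `Σ`), `s ∈ A` (the chart of the
member `H = V(s)`), regularity of `H` at a closed point `𝔪 ∋ s` read as
`IsRegularLocalRing (A_𝔪 ⧸ (s))`.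

**What is proved.** Serre's criterion `R₀ + S₁ ⇒ reduced` for the hypersurface `H = V(s)`, from the
tree's Cohen–Macaulay kit and Serre's localisation theorem, with no named facts:

* `isReduced_of_isReduced_localization_associatedPrimes` — a Noetherian ring whose localisations
  at its associated primes are reduced is reduced (an element killed by a unit at every associated
  prime is `0`).
* `isReduced_quotient_span_singleton_of_isRegularLocalRing` — **local core**: for a regular local
  ring `R` and `0 ≠ y ∈ 𝔪_R`, if `R_𝔮 ⧸ (y)` is a regular local ring at every prime `𝔮` of `R`
  minimal over `(y)` (condition `R₀` for `R ⧸ (y)`), then `R ⧸ (y)` is reduced. `S₁` is free: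
  `R ⧸ (y)` is Cohen–Macaulay (`RegularLocalRing.exists_isRegular_quotient_span_singleton`), hence
  unmixed (`CohenMacaulayUnmixed.minimalPrimes_of_mem_associatedPrimes`), so its associated primes
  are minimal, where the localisation `(R ⧸ (y))_𝔔 = R_𝔮 ⧸ (y)` is a regular local ring, a domain.
* `isRegularLocalRing_quotient_of_isMaximal_off` — **from closed points to all points off `V(𝔭)`**:
  if `A_𝔪 ⧸ (s)` is regular for every maximal `𝔪 ∋ s` with `𝔪 ⊉ 𝔭` (the regular half of
  `occurs_as_singular_locus`), then `A_𝔮 ⧸ (s)` is regular for every PRIME `𝔮 ∋ s` with `𝔮 ⊉ 𝔭`: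
  `A` is Jacobson, so some maximal `𝔪 ⊇ 𝔮` misses `𝔭`, and the regular locus of `A ⧸ (s)` is stable
  under generalisation (Serre, Matsumura 19.3; tree `NagataCriterion.mem_regularLocus_of_le`).
* `isReduced_quotient_span_singleton_of_regular_off` — **(R), affine kernel**: if moreover no
  prime of `A` minimal over `(s)` contains `𝔭` (the singular set `V(𝔭)` is nowhere dense in `H`),
  then `A ⧸ (s)` is reduced (reducedness is local, Mathlib `isReduced_ofLocalizationMaximal`;
  at a closed point `𝔪` the local ring `(A ⧸ (s))_𝔪 = A_𝔪 ⧸ (s)` is handled by the local core, its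
  `R₀` input coming from the previous item through `(A_𝔪)_𝔮 = A_𝔮`).
* `not_le_of_one_lt_height_of_mem_minimalPrimes` — the codimension hypothesis from `1 < ht 𝔭`
  (Krull's principal ideal theorem: primes minimal over `(s)` have height `≤ 1`); for the curve
  `Σ ⊂ ℙ³` of EL♮, `ht 𝔭 = 2` on every chart.
* `occurs_as_singular_locus_reduced`, `exists_reduced_hypersurface_singularLocus_eq` — **H-L0b with
  (R)**: for `1 < ht 𝔭` the generic member `s_t` of the affine `𝔭²`-system of p500339 has, besides
  `s_t ≠ 0`, `s_t ∈ 𝔭²` and «closed singular locus `= V(𝔭)`», a REDUCED coordinate ring `A ⧸ (s_t)`.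

**Still not covered, and said so**: (I) irreducibility of `V(s_t)` for `d ≫ 0` (named fact only,
Jouanolou 1983 Thm. 6.3(4)) and (G) the projective gluing of the affine charts — so «integral» of
§1.3 (b) is reduced to (I). References: Matsumura, *Commutative Ring Theory*, Thm. 17.8 with 17.4
(hypersurfaces in regular local rings are Cohen–Macaulay), Thm. 17.3/Stacks 0BUS (unmixedness),
Thm. 19.3 (Serre) [Matsumura1987]; the criterion `R₀ + S₁ ⇔ reduced` is [folklore] (Stacks 031R).
-/

set_option linter.dupNamespace false -- mandated namespace `Summit.<Summit>.<Problem>` of this single-conjunct summit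

noncomputable section

open IsLocalRing

universe u

namespace Summit.ResolutionOfSingularities.ResolutionOfSingularities.Cruxes.EquisingularLiftNat.Sections

open Literature.AlgebraicGeometry.Resolution Literature.AlgebraicGeometry.Resolution.BertiniAffine

/-! ## Reducedness from the associated primes -/

/-- **A Noetherian ring whose localisations at its associated primes are reduced is reduced.**
If `x ≠ 0` is nilpotent, its annihilator lies in some associated prime `𝔔` (Mathlib
`exists_le_isAssociatedPrime_of_isNoetherianRing`); the image of `x` in the reduced ring `B_𝔔` is
nilpotent, hence `0`, so some `u ∉ 𝔔` kills `x` — but `u ∈ Ann(x) ⊆ 𝔔`. [folklore] (Stacks 031R,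
proof) [OURS · L1 W4.5b] helper for H-L0b (R); NOT a statement of the manuscript. -/
theorem isReduced_of_isReduced_localization_associatedPrimes {B : Type u} [CommRing B]
    [IsNoetherianRing B]
    (h : ∀ (𝔔 : Ideal B) [𝔔.IsPrime], 𝔔 ∈ associatedPrimes B B →
      IsReduced (Localization.AtPrime 𝔔)) :
    IsReduced B := by
  refine ⟨fun x hx => ?_⟩
  by_contra hx0
  obtain ⟨𝔔, h𝔔, hcolon⟩ := exists_le_isAssociatedPrime_of_isNoetherianRing (R := B) (M := B) x hx0
  haveI : 𝔔.IsPrime := h𝔔.isPrime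
  haveI : IsReduced (Localization.AtPrime 𝔔) := h 𝔔 h𝔔
  have h0 : algebraMap B (Localization.AtPrime 𝔔) x = 0 :=
    (hx.map (algebraMap B (Localization.AtPrime 𝔔))).eq_zero
  obtain ⟨m, hm⟩ :=
    (IsLocalization.map_eq_zero_iff 𝔔.primeCompl (Localization.AtPrime 𝔔) x).mp h0
  have hmem : (m : B) ∈ (⊥ : Submodule B B).colon {x} := by
    rw [Submodule.mem_colon_singleton, smul_eq_mul, Submodule.mem_bot]
    exact hm
  exact m.2 (hcolon hmem)

/-! ## The local core: hypersurfaces in regular local rings -/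

/-- **Local core — a generically regular hypersurface in a regular local ring is reduced.** Let `R`
be a regular local ring, `0 ≠ y ∈ 𝔪_R`, and suppose that for every prime `𝔮` of `R` minimal over
`(y)` the local ring `R_𝔮 ⧸ (y)R_𝔮` is regular (condition `R₀` for `R ⧸ (y)`). Then `R ⧸ (y)` is
reduced. Proof: `R ⧸ (y)` carries a regular sequence of length its dimension (tree
`RegularLocalRing.exists_isRegular_quotient_span_singleton`, Matsumura 17.8/17.4), so by
unmixedness (tree `minimalPrimes_of_mem_associatedPrimes`, Stacks 0BUS) each associated prime `𝔔`
of `R ⧸ (y)` is minimal; its preimage `𝔮 ⊂ R` is minimal over `(y)` and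
`(R ⧸ (y))_𝔔 = R_𝔮 ⧸ (y)R_𝔮` is a regular local ring, a domain; conclude by
`isReduced_of_isReduced_localization_associatedPrimes`. [cite: Matsumura1987, Thm. 17.8 and
Thm. 17.3] [OURS · L1 W4.5b] helper for H-L0b (R); NOT a statement of the manuscript. -/
theorem isReduced_quotient_span_singleton_of_isRegularLocalRing {R : Type u} [CommRing R]
    [IsRegularLocalRing R] {y : R} (hy : y ∈ maximalIdeal R) (hy0 : y ≠ 0)
    (hmin : ∀ (𝔮 : Ideal R) [𝔮.IsPrime], 𝔮 ∈ (Ideal.span {y}).minimalPrimes →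
      IsRegularLocalRing (Localization.AtPrime 𝔮 ⧸
        (Ideal.span {y}).map (algebraMap R (Localization.AtPrime 𝔮)))) :
    IsReduced (R ⧸ Ideal.span {y}) := by
  set I : Ideal R := Ideal.span {y} with hI
  haveI := (isLocalRing_quotient_span_singleton hy).2
  -- `R ⧸ (y)` is Cohen–Macaulay: a regular sequence in its maximal ideal of length its dimension
  obtain ⟨rs, hmem, hreg, hlen⟩ :=
    Literature.RingTheory.RegularLocalRing.exists_isRegular_quotient_span_singleton R hy hy0
  refine isReduced_of_isReduced_localization_associatedPrimes fun 𝔔 _ h𝔔 => ?_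
  -- unmixedness: the associated prime `𝔔` is minimal
  have h𝔔min : 𝔔 ∈ minimalPrimes (R ⧸ I) := minimalPrimes_of_mem_associatedPrimes hreg hmem hlen h𝔔
  -- its preimage `𝔮` is a prime of `R` minimal over `(y)`
  set 𝔮 : Ideal R := 𝔔.comap (Ideal.Quotient.mk I) with h𝔮
  have h𝔮min : 𝔮 ∈ I.minimalPrimes := by
    rw [Ideal.minimalPrimes_eq_comap]
    exact ⟨𝔔, h𝔔min, rfl⟩
  have hreg𝔮 := hmin 𝔮 h𝔮min
  -- `(R ⧸ I)_𝔔 = R_𝔮 ⧸ I R_𝔮` (as in the tree's `FlatSliceAtPoint.isLocalization_atPrime_comap_quotient`)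
  have hM : Algebra.algebraMapSubmonoid (R ⧸ I) 𝔮.primeCompl = 𝔔.primeCompl := by
    ext b
    constructor
    · rintro ⟨c, hc, rfl⟩
      exact fun h => hc (Ideal.mem_comap.mpr h)
    · intro hb
      obtain ⟨c, rfl⟩ := Ideal.Quotient.mk_surjective b
      exact ⟨c, fun h => hb (Ideal.mem_comap.mp h), rfl⟩
  haveI : IsLocalization.AtPrime
      (Localization.AtPrime 𝔮 ⧸ I.map (algebraMap R (Localization.AtPrime 𝔮))) 𝔔 := by
    have := (inferInstance : IsLocalization (Algebra.algebraMapSubmonoid (R ⧸ I) 𝔮.primeCompl)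
      (Localization.AtPrime 𝔮 ⧸ I.map (algebraMap R (Localization.AtPrime 𝔮))))
    rwa [hM] at this
  haveI := hreg𝔮
  haveI : IsRegularLocalRing (Localization.AtPrime 𝔔) :=
    IsRegularLocalRing.of_ringEquiv (IsLocalization.algEquiv 𝔔.primeCompl
      (Localization.AtPrime 𝔮 ⧸ I.map (algebraMap R (Localization.AtPrime 𝔮)))
      (Localization.AtPrime 𝔔)).toRingEquiv
  haveI : IsDomain (Localization.AtPrime 𝔔) := isDomain_of_isRegularLocalRing _
  infer_instance

/-! ## From closed points to all points off `V(𝔭)` (Jacobson + Serre) -/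

variable {k : Type u} [Field k] {A : Type u} [CommRing A] [Algebra k A]

/-- **Regularity off `V(𝔭)` passes from closed points to all points.** Let `A` be a regular ring of
finite type over a field `k`, `𝔭 ⊆ A` an ideal and `s ∈ A` such that `A_𝔪 ⧸ (s)` is a regular
local ring for every maximal `𝔪 ∋ s` with `𝔪 ⊉ 𝔭` (the conclusion of Bertini off `V(𝔭)`,
`isGeneric_isRegularLocalRing_quotient_linComb_off`). Then `A_𝔮 ⧸ (s)` is a regular local ring
for every prime `𝔮 ∋ s` with `𝔮 ⊉ 𝔭`. Proof: `A` is Jacobson (Mathlib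
`isJacobsonRing_of_finiteType`), so `𝔮 = ⋂ {𝔪 maximal ⊇ 𝔮}` and some maximal `𝔪 ⊇ 𝔮` misses `𝔭`;
`A_𝔮 ⧸ (s) = ((A ⧸ (s))_{𝔪/(s)})_{𝔮/(s)}` is a localisation of the regular local ring `A_𝔪 ⧸ (s)`,
regular by Serre (Matsumura 19.3; tree `mem_regularLocus_of_le`,
`isRegularLocalRing_localization_quotient_iff`). [cite: Matsumura1987, Thm. 19.3]
[OURS · L1 W4.5b] helper for H-L0b (R); NOT a statement of the manuscript. -/
theorem isRegularLocalRing_quotient_of_isMaximal_off [IsRegularRing A] [Algebra.FiniteType k A]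
    (𝔭 : Ideal A) {s : A}
    (hoff : ∀ (𝔪 : Ideal A) [𝔪.IsMaximal], s ∈ 𝔪 → ¬ 𝔭 ≤ 𝔪 →
      IsRegularLocalRing (Localization.AtPrime 𝔪 ⧸
        Ideal.span {algebraMap A (Localization.AtPrime 𝔪) s}))
    (𝔮 : Ideal A) [𝔮.IsPrime] (hs𝔮 : s ∈ 𝔮) (hp𝔮 : ¬ 𝔭 ≤ 𝔮) :
    IsRegularLocalRing (Localization.AtPrime 𝔮 ⧸
      Ideal.span {algebraMap A (Localization.AtPrime 𝔮) s}) := by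
  classical
  haveI : IsJacobsonRing A := isJacobsonRing_of_finiteType (A := k) (B := A)
  -- a closed point over `𝔮` off `V(𝔭)`
  have hex : ∃ 𝔪 : Ideal A, 𝔪.IsMaximal ∧ 𝔮 ≤ 𝔪 ∧ ¬ 𝔭 ≤ 𝔪 := by
    by_contra hcon
    push Not at hcon
    apply hp𝔮
    have hjac : 𝔮.jacobson = 𝔮 := IsJacobsonRing.out ‹_› (Ideal.IsPrime.isRadical ‹_›)
    rw [← hjac]
    exact le_sInf fun J hJ => hcon J hJ.2 hJ.1
  obtain ⟨𝔪, h𝔪, h𝔮𝔪, hp𝔪⟩ := hex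
  haveI := h𝔪
  have hreg𝔪 := hoff 𝔪 (h𝔮𝔪 hs𝔮) hp𝔪
  -- pass to the local rings of `Spec (A ⧸ (s))`
  set I : Ideal A := Ideal.span {s} with hI
  have hspan : ∀ (P : Ideal A) [P.IsPrime],
      Ideal.span {algebraMap A (Localization.AtPrime P) s} =
        I.map (algebraMap A (Localization.AtPrime P)) := fun P _ => by
    rw [hI, Ideal.map_span, Set.image_singleton]
  have hI𝔮 : I ≤ 𝔮 := by
    rw [hI, Ideal.span_singleton_le_iff_mem]
    exact hs𝔮
  have hI𝔪 : I ≤ 𝔪 := hI𝔮.trans h𝔮𝔪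
  haveI := Ideal.isPrime_map_quotientMk_of_isPrime hI𝔮
  haveI := Ideal.isPrime_map_quotientMk_of_isPrime hI𝔪
  have hreg𝔪' : IsRegularLocalRing (Localization.AtPrime (𝔪.map (Ideal.Quotient.mk I))) := by
    rw [← isRegularLocalRing_localization_quotient_iff I 𝔪 hI𝔪]
    exact IsRegularLocalRing.of_ringEquiv (Ideal.quotEquivOfEq (hspan 𝔪))
  -- Serre: the regular locus of `A ⧸ (s)` is stable under generalisation
  have hle : (⟨𝔮.map (Ideal.Quotient.mk I), inferInstance⟩ : PrimeSpectrum (A ⧸ I)) ≤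
      ⟨𝔪.map (Ideal.Quotient.mk I), inferInstance⟩ :=
    (PrimeSpectrum.asIdeal_le_asIdeal _ _).mp (Ideal.map_mono h𝔮𝔪)
  have hreg𝔮' : IsRegularLocalRing (Localization.AtPrime (𝔮.map (Ideal.Quotient.mk I))) :=
    (mem_regularLocus _).mp (mem_regularLocus_of_le hle ((mem_regularLocus _).mpr hreg𝔪'))
  rw [← isRegularLocalRing_localization_quotient_iff I 𝔮 hI𝔮] at hreg𝔮'
  haveI := hreg𝔮'
  exact IsRegularLocalRing.of_ringEquiv (Ideal.quotEquivOfEq (hspan 𝔮).symm)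

/-! ## (R): the affine kernel -/

/-- **(R) Reducedness of a hypersurface which is regular off a nowhere dense closed subset —
affine kernel.** Let `A` be a regular domain of finite type over a field `k`, `𝔭 ⊆ A` an ideal and
`0 ≠ s ∈ A` such that (i) `A_𝔪 ⧸ (s)` is a regular local ring for every maximal `𝔪 ∋ s` with
`𝔪 ⊉ 𝔭` and (ii) no prime of `A` minimal over `(s)` contains `𝔭` (`V(𝔭) ∩ H` is nowhere dense in
`H = V(s)`; e.g. `1 < ht 𝔭`, `not_le_of_one_lt_height_of_mem_minimalPrimes`). Then the coordinate
ring `A ⧸ (s)` of `H` is reduced. Proof: reducedness is local (Mathlib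
`isReduced_ofLocalizationMaximal`); at a closed point `𝔪 ∋ s`, `(A ⧸ (s))_𝔪 = A_𝔪 ⧸ (s)` is
reduced by the local core `isReduced_quotient_span_singleton_of_isRegularLocalRing`, whose `R₀`
input at a prime `𝔮A_𝔪` minimal over `(s)` (so `𝔮` is minimal over `(s)` in `A`, Mathlib
`IsLocalization.minimalPrimes_map`, and misses `𝔭` by (ii)) is
`isRegularLocalRing_quotient_of_isMaximal_off` transported along `(A_𝔪)_𝔮 = A_𝔮`. [folklore]
(Serre's criterion, Stacks 031R) [cite: Matsumura1987, Thm. 17.8 and Thm. 19.3]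
[OURS · L1 W4.5b] helper H-L0b (R) toward `stub_elnat_three` of crux `EquisingularLiftNat`
(stmt-ResolutionOfSingularities-20038); NOT a statement of the manuscript. -/
theorem isReduced_quotient_span_singleton_of_regular_off [IsRegularRing A] [IsDomain A]
    [Algebra.FiniteType k A] (𝔭 : Ideal A) {s : A} (hs0 : s ≠ 0)
    (hoff : ∀ (𝔪 : Ideal A) [𝔪.IsMaximal], s ∈ 𝔪 → ¬ 𝔭 ≤ 𝔪 →
      IsRegularLocalRing (Localization.AtPrime 𝔪 ⧸
        Ideal.span {algebraMap A (Localization.AtPrime 𝔪) s}))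
    (hcod : ∀ 𝔮 ∈ (Ideal.span {s}).minimalPrimes, ¬ 𝔭 ≤ 𝔮) :
    IsReduced (A ⧸ Ideal.span {s}) := by
  classical
  set I : Ideal A := Ideal.span {s} with hI
  apply isReduced_ofLocalizationMaximal
  intro 𝔐 h𝔐
  -- the closed point `𝔪 ∋ s` of `Spec A` under `𝔐`
  set 𝔪 : Ideal A := 𝔐.comap (Ideal.Quotient.mk I) with h𝔪
  haveI : 𝔪.IsMaximal := Ideal.comap_isMaximal_of_surjective _ Ideal.Quotient.mk_surjective
  have hI𝔪 : I ≤ 𝔪 := fun x hx => by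
    rw [h𝔪, Ideal.mem_comap, Ideal.Quotient.eq_zero_iff_mem.mpr hx]
    exact 𝔐.zero_mem
  have hs𝔪 : s ∈ 𝔪 := hI𝔪 (Ideal.mem_span_singleton_self s)
  -- `R = A_𝔪`, `y = s`
  set R := Localization.AtPrime 𝔪 with hR
  set y : R := algebraMap A R s with hy
  have hy0 : y ≠ 0 := fun h =>
    hs0 ((IsLocalization.to_map_eq_zero_iff R (Ideal.primeCompl_le_nonZeroDivisors 𝔪)).mp h)
  have hym : y ∈ maximalIdeal R := by
    rw [hy, ← Localization.AtPrime.map_eq_maximalIdeal]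
    exact Ideal.mem_map_of_mem _ hs𝔪
  have hIy : Ideal.span {y} = I.map (algebraMap A R) := by
    show Ideal.span {y} = (Ideal.span {s}).map (algebraMap A R)
    rw [Ideal.map_span, Set.image_singleton]
  -- the local core at `𝔪`
  have hred : IsReduced (R ⧸ Ideal.span {y}) := by
    refine isReduced_quotient_span_singleton_of_isRegularLocalRing hym hy0 fun 𝔮R _ h𝔮R => ?_
    -- `𝔮 = 𝔮R ∩ A` is a prime of `A` minimal over `(s)`, hence misses `𝔭`
    have h𝔮 : 𝔮R.under A ∈ I.minimalPrimes := by
      rw [hIy, IsLocalization.minimalPrimes_map 𝔪.primeCompl R I] at h𝔮R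
      exact h𝔮R
    set 𝔮 : Ideal A := 𝔮R.under A with h𝔮def
    have hs𝔮 : s ∈ 𝔮 := h𝔮.1.2 (Ideal.mem_span_singleton_self s)
    have hreg := isRegularLocalRing_quotient_of_isMaximal_off (k := k) 𝔭 hoff 𝔮 hs𝔮 (hcod 𝔮 h𝔮)
    -- transport along `(A_𝔪)_{𝔮R} = A_𝔮`
    haveI : IsLocalization.AtPrime (Localization.AtPrime 𝔮R) 𝔮 :=
      IsLocalization.isLocalization_isLocalization_atPrime_isLocalization 𝔪.primeCompl
        (Localization.AtPrime 𝔮R) 𝔮R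
    let e : Localization.AtPrime 𝔮R ≃ₐ[A] Localization.AtPrime 𝔮 :=
      IsLocalization.algEquiv 𝔮.primeCompl (Localization.AtPrime 𝔮R) (Localization.AtPrime 𝔮)
    have hx : e.symm (algebraMap A (Localization.AtPrime 𝔮) s) =
        algebraMap R (Localization.AtPrime 𝔮R) y := by
      rw [hy, ← IsScalarTower.algebraMap_apply, e.symm.commutes]
    haveI := hreg
    refine IsRegularLocalRing.of_ringEquiv (R := Localization.AtPrime 𝔮 ⧸
      Ideal.span {algebraMap A (Localization.AtPrime 𝔮) s}) ?_
    refine Ideal.quotientEquiv _ _ e.symm.toRingEquiv ?_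
    rw [Ideal.map_span, Set.image_singleton, Ideal.map_span, Set.image_singleton]
    exact congrArg (fun z => Ideal.span {z}) (by rw [← hx]; rfl)
  -- `(A ⧸ (s))_𝔐 = A_𝔪 ⧸ (s) A_𝔪`
  haveI : 𝔐.IsPrime := h𝔐.isPrime
  have hM : Algebra.algebraMapSubmonoid (A ⧸ I) 𝔪.primeCompl = 𝔐.primeCompl := by
    ext b
    constructor
    · rintro ⟨c, hc, rfl⟩
      exact fun h => hc (Ideal.mem_comap.mpr h)
    · intro hb
      obtain ⟨c, rfl⟩ := Ideal.Quotient.mk_surjective b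
      exact ⟨c, fun h => hb (Ideal.mem_comap.mp h), rfl⟩
  haveI : IsLocalization.AtPrime (R ⧸ I.map (algebraMap A R)) 𝔐 := by
    have := (inferInstance : IsLocalization (Algebra.algebraMapSubmonoid (A ⧸ I) 𝔪.primeCompl)
      (R ⧸ I.map (algebraMap A R)))
    rwa [hM] at this
  let e := (IsLocalization.algEquiv 𝔐.primeCompl (R ⧸ I.map (algebraMap A R))
    (Localization.AtPrime 𝔐)).toRingEquiv
  haveI : IsReduced (R ⧸ I.map (algebraMap A R)) :=
    isReduced_of_injective (Ideal.quotEquivOfEq hIy).symm (Ideal.quotEquivOfEq hIy).symm.injective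
  exact isReduced_of_injective e.symm e.symm.injective

/-- **The codimension hypothesis from the height of `𝔭`**: if `1 < ht 𝔭` then no prime `𝔮` of the
Noetherian ring `A` minimal over a principal ideal `(s)` contains `𝔭` — by Krull's principal ideal
theorem `ht 𝔮 ≤ 1` (Mathlib `Ideal.height_le_one_of_isPrincipal_of_mem_minimalPrimes`). For the
curve `Σ ⊂ ℙ³_k` of EL♮ the chart ideal `𝔭` is a prime of height `2`. [folklore]
[OURS · L1 W4.5b] helper for H-L0b (R). -/
theorem not_le_of_one_lt_height_of_mem_minimalPrimes [IsNoetherianRing A] (𝔭 : Ideal A) {s : A}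
    (hht : 1 < 𝔭.height) (𝔮 : Ideal A) (h𝔮 : 𝔮 ∈ (Ideal.span {s}).minimalPrimes) : ¬ 𝔭 ≤ 𝔮 := by
  intro hle
  have h1 : 𝔮.height ≤ 1 :=
    Ideal.height_le_one_of_isPrincipal_of_mem_minimalPrimes (Ideal.span {s}) 𝔮 h𝔮
  exact not_lt.mpr ((Ideal.height_mono hle).trans h1) hht

/-! ## H-L0b with (R): the generic member of the `𝔭²`-system is reduced -/

/-- **H-L0b `occurs_as_singular_locus` with reducedness, affine kernel** (CRUX-PLAN v3.0.1 §1.3 (b)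
«`H := V(G)`, `G` generic in `H⁰(𝓘_Σ²(d))`, is integral with `Sing H = Σ`» — the clauses
`Sing H = Σ` (closed points) AND «`H` reduced», chart by chart). Let `A` be a regular domain of
finite type over an algebraically closed field `k` and `𝔭 ⊆ A` a non-zero ideal of height `> 1`
(e.g. the prime of a curve in a chart of dimension `3`). Then for the affine `𝔭²`-system `uⱼ` of
`occurs_as_singular_locus` (p500339) and GENERIC `t`: `s_t ≠ 0`, `s_t ∈ 𝔭²`, for every closed point
`𝔪 ∋ s_t` the local ring `A_𝔪 ⧸ (s_t)` is regular iff `𝔪 ⊉ 𝔭`, AND the coordinate ring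
`A ⧸ (s_t)` of `H = V(s_t)` is reduced (`isReduced_quotient_span_singleton_of_regular_off`: the
primes minimal over `(s_t)` have height `≤ 1 < ht 𝔭`). NOT covered: irreducibility of `V(s_t)` for
`d ≫ 0`, projective gluing. [cite: Hartshorne1977, II Thm. 8.18] [cite: Matsumura1987, Thm. 17.8
and Thm. 19.3] [OURS · L1 W4.5b] helper H-L0b toward `stub_elnat_three` of crux `EquisingularLiftNat`
(stmt-ResolutionOfSingularities-20038); NOT a statement of the manuscript. -/
theorem occurs_as_singular_locus_reduced [IsAlgClosed k] [IsRegularRing A] [IsDomain A]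
    [Algebra.FiniteType k A] (𝔭 : Ideal A) (h𝔭 : 𝔭 ≠ ⊥) (hht : 1 < 𝔭.height) :
    ∃ (ι : Type u) (_ : Fintype ι) (u : ι → A), (∀ j, u j ∈ 𝔭 ^ 2) ∧
      IsGeneric fun t : ι → k =>
        linComb u t ≠ 0 ∧ linComb u t ∈ 𝔭 ^ 2 ∧
        (∀ (𝔪 : Ideal A) [𝔪.IsMaximal], linComb u t ∈ 𝔪 →
          (IsRegularLocalRing (Localization.AtPrime 𝔪 ⧸
              Ideal.span {algebraMap A (Localization.AtPrime 𝔪) (linComb u t)}) ↔ ¬ 𝔭 ≤ 𝔪)) ∧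
        IsReduced (A ⧸ Ideal.span {linComb u t}) := by
  obtain ⟨ι, hι, u, hu2, hgen⟩ := occurs_as_singular_locus (k := k) 𝔭 h𝔭
  refine ⟨ι, hι, u, hu2, hgen.mono fun t ht => ⟨ht.1, ht.2.1, ht.2.2, ?_⟩⟩
  refine isReduced_quotient_span_singleton_of_regular_off (k := k) 𝔭 ht.1
    (fun 𝔪 h𝔪 hst hp𝔪 => ?_) (fun 𝔮 h𝔮 => not_le_of_one_lt_height_of_mem_minimalPrimes 𝔭 hht 𝔮 h𝔮)
  haveI := h𝔪
  exact (ht.2.2 𝔪 hst).mpr hp𝔪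

/-- **Corollary (a reduced witness exists).** Under the hypotheses of
`occurs_as_singular_locus_reduced` some `0 ≠ s ∈ 𝔭²` has closed singular locus `V(𝔭)` (on closed
points) and a reduced coordinate ring `A ⧸ (s)` (`k` is infinite, `IsGeneric.nonempty`).
[OURS · L1 W4.5b] helper H-L0b (R); NOT a statement of the manuscript. -/
theorem exists_reduced_hypersurface_singularLocus_eq [IsAlgClosed k] [IsRegularRing A] [IsDomain A]
    [Algebra.FiniteType k A] (𝔭 : Ideal A) (h𝔭 : 𝔭 ≠ ⊥) (hht : 1 < 𝔭.height) :
    ∃ s : A, s ≠ 0 ∧ s ∈ 𝔭 ^ 2 ∧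
      (∀ (𝔪 : Ideal A) [𝔪.IsMaximal], s ∈ 𝔪 →
        (IsRegularLocalRing (Localization.AtPrime 𝔪 ⧸
            Ideal.span {algebraMap A (Localization.AtPrime 𝔪) s}) ↔ ¬ 𝔭 ≤ 𝔪)) ∧
      IsReduced (A ⧸ Ideal.span {s}) := by
  obtain ⟨ι, hι, u, -, hgen⟩ := occurs_as_singular_locus_reduced (k := k) 𝔭 h𝔭 hht
  haveI : Infinite k := IsAlgClosed.instInfinite
  obtain ⟨t, ht⟩ := hgen.nonempty
  exact ⟨linComb u t, ht.1, ht.2.1, fun 𝔪 _ hst => ht.2.2.1 𝔪 hst, ht.2.2.2⟩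

end Summit.ResolutionOfSingularities.ResolutionOfSingularities.Cruxes.EquisingularLiftNat.Sections

end
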